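import Summits.ResolutionOfSingularities.ResolutionOfSingularities.Theorems.FrobeniusClosingPatchingRelPerfectDepthWeightTwoBNrPieceStepOut
import Summits.ResolutionOfSingularities.ResolutionOfSingularities.Theorems.FrobeniusClosingPatchingRelPerfectDepthWeightTwoBLoop
import Summits.ResolutionOfSingularities.ResolutionOfSingularities.Theorems.FrobeniusClosingPatchingRelPerfectDepthWeightTwoBCJS
import HarnessLib

/-!
# Crux `PatchingRelPerfect` (stmt-ResolutionOfSingularities-16161), chain W5.2 — F5c / TargetsF5c T5-E^nr «W₂B WITHOUT REDUCEDNESS»: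
# the PIECES LOOP and the CJS TRANSPORT re-keyed on `StateNr` (no `IsReduced 𝔟.subscheme`)

[OURS · L1 W5.2 · TargetsF5c T5-E^nr (res-L1-w52-plan-1 STEER 4 2026-08-27T11:07:07Z; owner res-D-pv-052 AS res-L1-w52-stub-7).]
Fact-free; NOT statements of the manuscript under review (Hironaka 2017); AI-written, weaker than expert review.

This is res-type-049's `…DepthWeightTwoBLoop` (T5-E, p519856: `pieces_loop_single`, `pieces_loop`, over res-D-pv-054's spec) with
`WeightTwoB.StateIn` replaced by `WeightTwoB.StateNr` and the reducedness output dropped: the single-piece step no longer computes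
`hrad` ((L-D) is not needed), the new state is `Nr.stateNr'`, and the centre data of the remaining pieces are transported by the
state-free `Nr.centreIn_transport`.  Everything else — the piece partition `IsPiecePartition`, `isBlowup_restrict_complPiece`,
`comap_vanishingIdeal_complPiece`, `stepExp`, the `cons` clause list fed from `WeightTwoB.PieceIn` — is used BY NAME.
Then `Nr.cjs_transport` = res-D-pv-054's `WeightTwoB.cjs_transport` (…DepthWeightTwoBCJS p520851) VERBATIM with `StateNr.init` (ANY
non-zero locally principal `𝔟`) for `StateIn.init` (which needed `IsReduced 𝔟.subscheme`) and `Nr.pieces_loop`: ISO-TOLERANT induction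
over the F-32bR INPUT `IsBPermissibleSequenceB (Supp 𝔟) ∅ σ X' B'` (fact-free: the sequence is a hypothesis), output an
`IsWeightedSeqJR 2` sequence from `(𝔟, 𝔟, [], [])`, the final `StateNr`, `Supp D' = e⁻¹(cl X')` and the boundary bound; the END
(factorisation of the final host, one PEEL per multiple component — res-L1-w52-stub-1's `isWeightedSeqJR_peel` p527073 —, reduced
end) is the companion `…NrEnd` (res-D-pv-055 / res-L1-w52-stub-1 / owner).  Namespace `WeightTwoB.Nr`.

## References
* E. Bierstone, D. Grigoriev, P. Milman, J. Włodarczyk, arXiv:1206.3090, §4 Step 2b, §3.2 Lemma 3.2.1, Def. 3.1.3. [BierstoneGrigorievMilmanWlodarczyk2011]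
* V. Cossart, U. Jannsen, S. Saito, LNM 2270 (2020), Thm. 1.4, Def. 4.1, (6.2). [CossartJannsenSaito2020]
* J. Kollár, *Lectures on Resolution of Singularities* (2007), 3.30.2. [Kollar2007]
* The Stacks Project, Tags 080A, 02OS. [StacksProject]
* J. Kollár, (3.111) Step 1 for the CJS-driven E-side. [Kollar2007]
-/

-- `Summit.<Summit>.<Sub>.Theorems` with `Sub = Summit` (single-conjunct summit, D-0017)
set_option linter.dupNamespace false

noncomputable section

open CategoryTheory CategoryTheory.Limits AlgebraicGeometry TopologicalSpace IsLocalRing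
open Literature.AlgebraicGeometry.Resolution Scheme.IdealSheafData

namespace Summit.ResolutionOfSingularities.ResolutionOfSingularities.Theorems

universe u

namespace WeightTwoB

namespace Nr

open DepthTargets

/-! ## One piece -/

/-- **The single-piece step, packaged**: blowing up ONE piece `Z` (irreducible regular centre piece with its `CentreIn` data) of
the current transport state extends the weighted sequence with boundary by one `IsWeightedSeqJR.cons` step — weight
`ν = pieceWeight 𝔟 Z`, host order `m = ord_η D`, new lists `stepExp` — and yields the new transport state, the reducedness and the
support of the carried host (no reducedness: T5-E^nr), and the boundary bound. The witnesses `m, e, e'` are exposed so that the centre data of further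
(disjoint) pieces can be transported with `Nr.centreIn_transport` (res-D-pv-054's `CentreIn.transport`, reducedness-free).
[cite: BierstoneGrigorievMilmanWlodarczyk2011, §4 Step 2b, §3.2 Lemma 3.2.1] [cite: Kollar2007, 3.30.2] -/
theorem pieces_loop_single
    {E W : Scheme.{u}} [IsIntegral W] [IsNoetherian W] {ρ : W ⟶ E} {𝔟₀ : E.IdealSheafData}
    {𝔟 D : W.IdealSheafData} {ℬ 𝒟 : List (W.IdealSheafData × ℕ)} (S : StateNr 𝔟 D ℬ 𝒟)
    (hseq : IsWeightedSeqJR 2 ρ 𝔟₀ 𝔟₀ [] [] 𝔟 D ℬ 𝒟)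
    {Z : Closeds W} (Γ : CentreIn D ℬ Z)
    {B₀ : Set W} (hℬB : ∀ p ∈ ℬ, (p.1.support : Set W) ⊆ B₀) (hZB : (Z : Set W) ⊆ B₀)
    {W' : Scheme.{u}} {τ : W' ⟶ W} (hτ : IsBlowup τ (vanishingIdeal Z)) :
    ∃ (_ : IsIntegral W') (_ : IsNoetherian W') (m e e' : ℕ),
      IsWeightedSeqJR 2 (τ ≫ ρ) 𝔟₀ 𝔟₀ [] []
          (controlledTransform τ (vanishingIdeal Z) 𝔟 (pieceWeight 𝔟 (Z : Set W)))
          (controlledTransform τ (vanishingIdeal Z) D m)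
          (stepExp ℬ τ (vanishingIdeal Z) e) (stepExp 𝒟 τ (vanishingIdeal Z) e') ∧
        StateNr (controlledTransform τ (vanishingIdeal Z) 𝔟 (pieceWeight 𝔟 (Z : Set W)))
          (controlledTransform τ (vanishingIdeal Z) D m)
          (stepExp ℬ τ (vanishingIdeal Z) e) (stepExp 𝒟 τ (vanishingIdeal Z) e') ∧
        (((controlledTransform τ (vanishingIdeal Z) D m).support : Set W') =
          closure (τ ⁻¹' ((D.support : Set W) \ (Z : Set W)))) ∧
        (∀ p ∈ stepExp ℬ τ (vanishingIdeal Z) e, (p.1.support : Set W') ⊆ τ ⁻¹' B₀) := by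
  obtain ⟨η, hη⟩ := Γ.exists_isGenericPoint
  have P : PieceIn 𝔟 D ℬ 𝒟 Z η := S.pieceIn Γ hη
  obtain ⟨m, hm, hm1⟩ := P.exists_idealOrder_host_eq
  -- the centre is not the zero ideal: `Z ⊆ Supp D`, a proper closed subset
  have hCne : vanishingIdeal Z ≠ ⊥ := by
    intro h0
    have hZ : (Z : Set W) = Set.univ := by
      rw [← Scheme.IdealSheafData.coe_support_vanishingIdeal Z, h0, Scheme.IdealSheafData.support_bot]; rfl
    have hdense := S.hostCartier.dense_compl_support
    have hempty : ((D.support : Set W)ᶜ) = ∅ := by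
      rw [Set.compl_empty_iff, Set.eq_univ_iff_forall]
      intro x
      exact Γ.subZ (by rw [hZ]; trivial)
    have := hdense.nonempty
    rw [hempty] at this
    exact Set.not_nonempty_empty this
  haveI hint' : IsIntegral W' := hτ.isIntegral hCne
  haveI hnoeth' : IsNoetherian W' := isNoetherian_of_isBlowup hτ
  set ν := pieceWeight 𝔟 (Z : Set W) with hν
  set w := weightOf ℬ (divisorsOver ℬ (vanishingIdeal Z) (vanishingIdeal Z).support) with hw
  set w𝒟 := weightOf 𝒟 (divisorsOver 𝒟 (vanishingIdeal Z) (vanishingIdeal Z).support) with hw𝒟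
  refine ⟨hint', hnoeth', m, m + w - ν, w𝒟 + (2 - ν), ?_, ?_, support_host' S Γ hη hτ hm, ?_⟩
  · -- the `cons` step
    have hZsupp : ∀ {z : W}, z ∈ (vanishingIdeal Z).support → z ∈ (Z : Set W) := fun {z} hz => by
      rwa [← Scheme.IdealSheafData.coe_support_vanishingIdeal Z]
    exact IsWeightedSeqJR.cons τ ρ 𝔟₀ 𝔟₀ [] [] 𝔟 D ℬ 𝒟 (vanishingIdeal Z) ν m hseq Γ.regZ P.isPreconnected
      (one_le_pieceWeight 𝔟 _) (pieceWeight_le_two 𝔟 _) P.le_pow_weight (P.host_le_pow hm) (P.weight_le_add hm hm1) Γ.sncZ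
      P.uniformPieces.1 P.uniformPieces.2 (fun z hz hreq => P.joint_clause (hZsupp hz) hreq)
      (fun hlt z hz => P.maxWeight_clause hlt (hZsupp hz)) hτ (not_host'_le_strict S Γ hτ) (not_host'_le_exc S Γ hη hτ hm)
  · -- the new state
    exact stateNr' S Γ hη hτ hm
  · -- the boundary bound
    intro p hp
    rcases mem_stepExp_iff.mp hp with ⟨q, hq, rfl⟩ | rfl
    · intro x' hx'
      exact hℬB q hq (mem_support_of_mem_support_strictTransformIdeal hx')
    · intro x' hx'
      rw [Scheme.IdealSheafData.support_comap, Closeds.coe_preimage, Scheme.IdealSheafData.coe_support_vanishingIdeal] at hx'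
      exact hZB hx'

/-! ## The loop -/

/-- The induction behind `pieces_loop`, on the number of pieces. [cite: BierstoneGrigorievMilmanWlodarczyk2011, §4 Step 2b] -/
private theorem pieces_loop_aux {E : Scheme.{u}} {𝔟₀ : E.IdealSheafData} (n : ℕ) :
    ∀ {W : Scheme.{u}} [IsIntegral W] [IsNoetherian W] {ρ : W ⟶ E}
      {𝔟 D : W.IdealSheafData} {ℬ 𝒟 : List (W.IdealSheafData × ℕ)} (_S : StateNr 𝔟 D ℬ 𝒟)
      (_hseq : IsWeightedSeqJR 2 ρ 𝔟₀ 𝔟₀ [] [] 𝔟 D ℬ 𝒟)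
      {C : W.IdealSheafData} (_hC : Scheme.IsRegular C.subscheme)
      {Zs : List (Closeds W)} (_hlen : Zs.length = n) (_hne : Zs ≠ []) (_hP : IsPiecePartition C Zs)
      (_hΓ : ∀ Z ∈ Zs, CentreIn D ℬ Z)
      {B₀ : Set W} (_hℬB : ∀ p ∈ ℬ, (p.1.support : Set W) ⊆ B₀) (_hCB : (C.support : Set W) ⊆ B₀)
      {W' : Scheme.{u}} {τ : W' ⟶ W} (_hτ : IsBlowup τ C),
      ∃ (_ : IsIntegral W') (_ : IsNoetherian W') (𝔟' D' : W'.IdealSheafData) (ℬ' 𝒟' : List (W'.IdealSheafData × ℕ)),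
        IsWeightedSeqJR 2 (τ ≫ ρ) 𝔟₀ 𝔟₀ [] [] 𝔟' D' ℬ' 𝒟' ∧ StateNr 𝔟' D' ℬ' 𝒟' ∧
        ((D'.support : Set W') = closure (τ ⁻¹' ((D.support : Set W) \ C.support))) ∧
        (∀ p ∈ ℬ', (p.1.support : Set W') ⊆ τ ⁻¹' B₀) := by
  induction n with
  | zero =>
    intro W _ _ ρ 𝔟 D ℬ 𝒟 S hseq C hC Zs hlen hne
    exact absurd (List.eq_nil_of_length_eq_zero hlen) hne
  | succ n ih =>
    intro W _ _ ρ 𝔟 D ℬ 𝒟 S hseq C hC Zs hlen hne hP hΓ B₀ hℬB hCB W' τ hτ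
    obtain ⟨Z, Zs', rfl⟩ : ∃ Z Zs', Zs = Z :: Zs' := by
      cases Zs with
      | nil => exact absurd rfl hne
      | cons Z Zs' => exact ⟨Z, Zs', rfl⟩
    have hlen' : Zs'.length = n := by simpa using hlen
    have hZC : (Z : Set W) ⊆ (C.support : Set W) := by
      rw [← hP.2]
      exact Set.subset_iUnion₂ (s := fun (Z' : Closeds W) (_ : Z' ∈ Z :: Zs') => (Z' : Set W)) Z List.mem_cons_self
    have hZB : (Z : Set W) ⊆ B₀ := hZC.trans hCB
    by_cases hnil : Zs' = []
    · -- ONE piece: `C = 𝓘(Z)`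
      subst hnil
      have hCZ : C = vanishingIdeal Z := by
        rw [← prod_pieceIdeals_eq_of_isRegular hC hP]; simp [pieceIdeals]
      subst hCZ
      obtain ⟨hint', hnoeth', m, e, e', hseq', S', hsupp, hbd⟩ :=
        pieces_loop_single S hseq (hΓ Z List.mem_cons_self) hℬB hZB hτ
      refine ⟨hint', hnoeth', _, _, _, _, hseq', S', ?_, hbd⟩
      rw [hsupp, Scheme.IdealSheafData.coe_support_vanishingIdeal]
    · -- SEVERAL pieces: peel the first
      obtain ⟨X₁, τ₁, τ₂, hcomp, hτ₁, -, -, -, -, hτ₂, hC₁, hP₁⟩ := hτ.exists_comp_eq_of_isPiecePartition_cons hC hP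
      obtain ⟨hint₁, hnoeth₁, m, e, e', hseq₁, S₁, hsupp₁, hbd₁⟩ :=
        pieces_loop_single S hseq (hΓ Z List.mem_cons_self) hℬB hZB hτ₁
      haveI := hint₁
      haveI := hnoeth₁
      -- the centre data of the lifted remaining pieces
      have hΓ₁ : ∀ Z₁ ∈ Zs'.map (fun W₀ : Closeds W => W₀.preimage τ₁.continuous),
          CentreIn (controlledTransform τ₁ (vanishingIdeal Z) D m) (stepExp ℬ τ₁ (vanishingIdeal Z) e) Z₁ := by
        intro Z₁ hZ₁
        obtain ⟨Z₂, hZ₂, rfl⟩ := List.mem_map.mp hZ₁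
        exact Nr.centreIn_transport (m := m) (hΓ Z List.mem_cons_self) hτ₁ (hΓ Z₂ (List.mem_cons_of_mem _ hZ₂))
          (hP.disjoint_of_mem_tail hZ₂) e
      have hne₁ : Zs'.map (fun W₀ : Closeds W => W₀.preimage τ₁.continuous) ≠ [] := by
        simpa using hnil
      have hlen₁ : (Zs'.map (fun W₀ : Closeds W => W₀.preimage τ₁.continuous)).length = n := by simpa using hlen'
      -- the support of the remaining centre lies over `⋃ Zs' ⊆ V(C) ⊆ B₀`
      set T : Set W := ⋃ Z₂ ∈ Zs', (Z₂ : Set W) with hT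
      have hC₁supp : (((pieceIdeals (Zs'.map fun W₀ : Closeds W => W₀.preimage τ₁.continuous)).prod).support : Set X₁) =
          τ₁ ⁻¹' T := by
        rw [← hP₁.2, hT]
        ext x
        simp only [List.mem_map, Set.mem_iUnion, exists_prop, Set.mem_preimage]
        constructor
        · rintro ⟨_, ⟨Z₂, hZ₂, rfl⟩, hx⟩
          exact ⟨Z₂, hZ₂, hx⟩
        · rintro ⟨Z₂, hZ₂, hx⟩
          exact ⟨_, ⟨Z₂, hZ₂, rfl⟩, hx⟩
      have hTC : T ⊆ (C.support : Set W) := by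
        rw [← hP.2, hT]
        exact Set.iUnion₂_subset fun Z₂ hZ₂ =>
          Set.subset_iUnion₂ (s := fun (Z' : Closeds W) (_ : Z' ∈ Z :: Zs') => (Z' : Set W)) Z₂ (List.mem_cons_of_mem _ hZ₂)
      have hZT : (Z : Set W) ∪ T = (C.support : Set W) := by
        rw [← hP.2, hT]
        ext x
        simp only [Set.mem_union, Set.mem_iUnion, List.mem_cons, exists_prop]
        constructor
        · rintro (hx | ⟨Z₂, hZ₂, hx⟩)
          · exact ⟨Z, Or.inl rfl, hx⟩
          · exact ⟨Z₂, Or.inr hZ₂, hx⟩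
        · rintro ⟨Z', rfl | hZ', hx⟩
          · exact Or.inl hx
          · exact Or.inr ⟨Z', hZ', hx⟩
      have hCB₁ : (((pieceIdeals (Zs'.map fun W₀ : Closeds W => W₀.preimage τ₁.continuous)).prod).support : Set X₁) ⊆
          τ₁ ⁻¹' B₀ := by
        rw [hC₁supp]; exact Set.preimage_mono (hTC.trans hCB)
      -- the induction hypothesis on the remaining pieces
      obtain ⟨hint', hnoeth', 𝔟', D', ℬ', 𝒟', hseq', S', hsupp', hbd'⟩ :=
        ih S₁ hseq₁ hC₁ hlen₁ hne₁ hP₁ hΓ₁ hbd₁ hCB₁ hτ₂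
      refine ⟨hint', hnoeth', 𝔟', D', ℬ', 𝒟', ?_, S', ?_, ?_⟩
      · rw [← hcomp, Category.assoc]; exact hseq'
      · -- supports: two-step strict transform = one-step ((L-G))
        rw [hsupp', hsupp₁, hC₁supp, hτ₂.closure_preimage_closure_preimage_diff τ₁ hC₁supp (D.support : Set W) (Z : Set W),
          hcomp, hZT]
      · intro p hp x' hx'
        have h1 := hbd' p hp hx'
        rw [← hcomp]
        simp only [Set.mem_preimage, Scheme.Hom.comp_base, TopCat.coe_comp, Function.comp_apply] at h1 ⊢
        exact h1

/-- [OURS · L1 W5.2 · T5-E^nr] **THE PIECES LOOP, T5-E^nr** (res-type-049's `WeightTwoB.pieces_loop` re-keyed on `StateNr`): from a transport state `StateNr 𝔟 D ℬ 𝒟` at the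
end of a weighted sequence with boundary `IsWeightedSeqJR 2 ρ 𝔟₀ 𝔟₀ [] [] 𝔟 D ℬ 𝒟`, a regular centre `C` with a non-empty piece
partition `Zs` each piece carrying its `CentreIn` data, a boundary bound `B₀`, and ANY blowing up `τ` along `C`, the sequence
extends along `τ` (one `cons` per piece, maximal weights), to a transport state on `W'` whose host support is the strict
transform `cl τ⁻¹(Supp D ∖ V(C))` and whose boundary lies over `B₀`.
[cite: BierstoneGrigorievMilmanWlodarczyk2011, §4 Step 2b, Def. 3.1.3] [cite: CossartJannsenSaito2020, Thm. 1.4, (6.2)]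
[cite: StacksProject, Tag 080A] -/
theorem pieces_loop
    {E W : Scheme.{u}} [IsIntegral W] [IsNoetherian W] {ρ : W ⟶ E} {𝔟₀ : E.IdealSheafData}
    {𝔟 D : W.IdealSheafData} {ℬ 𝒟 : List (W.IdealSheafData × ℕ)} (S : StateNr 𝔟 D ℬ 𝒟)
    (hseq : DepthTargets.IsWeightedSeqJR 2 ρ 𝔟₀ 𝔟₀ [] [] 𝔟 D ℬ 𝒟)
    {C : W.IdealSheafData} (hC : Scheme.IsRegular C.subscheme)
    {Zs : List (Closeds W)} (hne : Zs ≠ []) (hP : IsPiecePartition C Zs) (hΓ : ∀ Z ∈ Zs, CentreIn D ℬ Z)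
    {B₀ : Set W} (hℬB : ∀ p ∈ ℬ, (p.1.support : Set W) ⊆ B₀) (hCB : (C.support : Set W) ⊆ B₀)
    {W' : Scheme.{u}} {τ : W' ⟶ W} (hτ : IsBlowup τ C) :
    ∃ (_ : IsIntegral W') (_ : IsNoetherian W') (𝔟' D' : W'.IdealSheafData) (ℬ' 𝒟' : List (W'.IdealSheafData × ℕ)),
      DepthTargets.IsWeightedSeqJR 2 (τ ≫ ρ) 𝔟₀ 𝔟₀ [] [] 𝔟' D' ℬ' 𝒟' ∧ StateNr 𝔟' D' ℬ' 𝒟' ∧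
      ((D'.support : Set W') = closure (τ ⁻¹' ((D.support : Set W) \ C.support))) ∧
      (∀ p ∈ ℬ', (p.1.support : Set W') ⊆ τ ⁻¹' B₀) :=
  pieces_loop_aux Zs.length S hseq hC rfl hne hP hΓ hℬB hCB hτ

/-! ## The CJS transport (no `IsReduced`) -/

section CJS

open DepthSNC


/-! ## The CJS induction -/

/-- **Transport along the CJS sequence** (see the module docstring): ISO-TOLERANT induction over `IsBPermissibleSequenceB`.
[cite: CossartJannsenSaito2020, Thm. 1.4, (6.2), Def. 3.1, Def. 4.1] [cite: Kollar2007, (3.111) Step 1] -/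
theorem cjs_transport {E : Scheme.{u}} [IsIntegral E] [IsNoetherian E] (hE : Scheme.IsRegular E)
    (𝔟 : E.IdealSheafData) (h𝔟 : 𝔟 ≠ ⊥) (hlp : IsLocallyPrincipal 𝔟) :
    ∀ {Z' : Scheme.{u}} {σ : Z' ⟶ E} {X' B' : Set Z'},
      IsBPermissibleSequenceB (𝔟.support : Set E) (∅ : Set E) σ X' B' →
      IsClosed X' ∧ ∃ (E' : Scheme.{u}) (_ : IsIntegral E') (_ : IsNoetherian E') (_ : IsNoetherian Z') (ρ : E' ⟶ E)
        (e : E' ≅ Z') (𝔟' D' : E'.IdealSheafData) (ℬ' 𝒟' : List (E'.IdealSheafData × ℕ)),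
        IsWeightedSeqJR 2 ρ 𝔟 𝔟 [] [] 𝔟' D' ℬ' 𝒟' ∧ StateNr 𝔟' D' ℬ' 𝒟' ∧
        ((D'.support : Set E') = e.hom ⁻¹' closure X') ∧ (∀ p ∈ ℬ', (p.1.support : Set E') ⊆ e.hom ⁻¹' B') := by
  intro Z' σ X' B' h
  induction h with
  | refl =>
    refine ⟨𝔟.support.isClosed, E, inferInstance, inferInstance, inferInstance, 𝟙 E, Iso.refl E, 𝔟, 𝔟, [], [],
      IsWeightedSeqJR.nil 𝔟 𝔟 [] [] (by rw [monomialIdeal_nil, Scheme.IdealSheafData.mul_top]) (fun p hp => by simp at hp),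
      StateNr.init hE h𝔟 hlp, ?_, fun p hp => by simp at hp⟩
    rw [𝔟.support.isClosed.closure_eq, Iso.refl_hom, preimage_id']
  | @blowup Z' Z'' σ X' B' _ C τ hτ hreg hsub _ hperm hnc ih =>
    obtain ⟨hX'c, E', hint, hnoeth, hnoethZ, ρ, e, 𝔟', D', ℬ', 𝒟', hseq, S, hsupp, hbd⟩ := ih
    haveI := hint
    haveI := hnoeth
    haveI := hnoethZ
    haveI : IsNoetherian Z'' := isNoetherian_of_isBlowup hτ
    have hclX : closure X' = X' := hX'c.closure_eq
    refine ⟨isClosed_closure, ?_⟩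
    by_cases hC0 : C = ⊤
    · /- EMPTY centre: `τ` is an isomorphism, absorbed into `e` -/
      haveI := isIso_of_isBlowup_top hτ hC0
      have hCs : (C.support : Set Z') = ∅ := by
        rw [hC0, Scheme.IdealSheafData.support_top]; rfl
      refine ⟨E', hint, hnoeth, inferInstance, ρ, e ≪≫ (asIso τ).symm, 𝔟', D', ℬ', 𝒟', hseq, S, ?_, fun p hp => ?_⟩
      · rw [hsupp, hCs, Set.sdiff_empty, hclX, closure_closure, (hX'c.preimage τ.continuous).closure_eq, Iso.trans_hom,
          Iso.symm_hom, asIso_inv, preimage_comp', preimage_inv_preimage]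
      · rw [hCs, Set.union_empty, Iso.trans_hom, Iso.symm_hom, asIso_inv, preimage_comp', preimage_inv_preimage]
        exact hbd p hp
    · /- NON-EMPTY centre: re-sequence along the pieces of `e^* C` on `E'` -/
      have hCne : (C.support : Set Z').Nonempty := by
        rw [Set.nonempty_iff_ne_empty]
        intro h0
        apply hC0
        rw [← Scheme.IdealSheafData.support_eq_bot_iff]
        exact Closeds.ext h0
      -- the centre read on `E'`, and the blow-up `τ ≫ e⁻¹` along it
      have hC₀reg : Scheme.IsRegular (C.comap e.hom).subscheme := isRegular_subscheme_comap_of_isOpenImmersion e.hom C hreg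
      have hτ₀ : IsBlowup (τ ≫ e.inv) (C.comap e.hom) := by
        have h := hτ.comp_iso e.symm
        rwa [Iso.symm_hom, Iso.symm_inv] at h
      have hC₀s : ((C.comap e.hom).support : Set E') = e.hom ⁻¹' C.support := by
        rw [support_comap]; rfl
      have hCX : (C.support : Set Z') ⊆ closure X' := by
        intro y hy
        have h : y ∈ ((vanishingIdeal (⟨closure X', isClosed_closure⟩ : Closeds Z')).support : Set Z') :=
          support_antitone hsub hy
        rwa [Scheme.IdealSheafData.coe_support_vanishingIdeal] at h
      have hC₀D : ((C.comap e.hom).support : Set E') ⊆ D'.support := by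
        rw [hC₀s, hsupp]; exact Set.preimage_mono hCX
      -- the pieces of the centre
      have hP : IsPiecePartition (C.comap e.hom) (Kollar2007.boundaryPieces (C.comap e.hom)) :=
        isPiecePartition_boundaryPieces_of_isRegular hC₀reg
      have hne : Kollar2007.boundaryPieces (C.comap e.hom) ≠ [] := by
        intro h0
        rw [boundaryPieces_eq_nil_iff] at h0
        obtain ⟨y, hy⟩ := hCne
        have h : e.inv y ∈ ((C.comap e.hom).support : Set E') := by
          rw [hC₀s, Set.mem_preimage, hom_inv_apply]; exact hy
        rw [h0, Scheme.IdealSheafData.support_top] at h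
        exact h
      -- the boundary has snc with the centre (P3 on `Z'`, pushed through `e`)
      have hsncC : HasSNCWith (boundaryOf ℬ') (C.comap e.hom) :=
        hasSNCWith_comap_of_isNormalCrossingWith e S.sncB
          (fun K hK => by obtain ⟨p, hp, rfl⟩ := List.mem_map.mp hK; exact hbd p hp)
          (eq_vanishingIdeal_support_of_isRegular C hreg) hnc
      -- the reduced host ideal read through `e`
      have hDcomap : (vanishingIdeal (⟨closure X', isClosed_closure⟩ : Closeds Z')).comap e.hom = vanishingIdeal D'.support := by
        rw [comap_hom_vanishingIdeal]; congr 1; exact (Closeds.ext hsupp).symm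
      -- the centre data of every piece
      have hΓ : ∀ Z ∈ Kollar2007.boundaryPieces (C.comap e.hom), CentreIn D' ℬ' Z := fun Z hZ =>
        { irred := isIrreducible_of_mem_boundaryPieces hZ
          regZ := isRegular_subscheme_vanishingIdeal_piece hC₀reg hP hZ
          subZ := fun x hx => hC₀D (hP.subset hZ hx)
          sncZ := hsncC.centrePiece hP hZ
          perm := fun z hz => by
            have hzC₀ : z ∈ ((C.comap e.hom).support : Set E') := hP.subset hZ hz
            have hzC : e.hom z ∈ (C.support : Set Z') := by rwa [hC₀s] at hzC₀
            let φ : Z'.presheaf.stalk (e.hom z) ≃+* E'.presheaf.stalk z := (asIso (e.hom.stalkMap z)).commRingCatIsoToRingEquiv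
            have hφ : (φ : Z'.presheaf.stalk (e.hom z) →+* E'.presheaf.stalk z) = (e.hom.stalkMap z).hom := rfl
            have h := isPermissible_map_map_of_ringEquiv φ (hperm (e.hom z) hzC)
            rw [hφ, ← stalkIdeal_comap_eq_map, ← stalkIdeal_comap_eq_map, hDcomap] at h
            rwa [stalkIdeal_centrePiece_eq hC₀reg hP hZ hz] }
      -- the pieces loop
      obtain ⟨hint'', hnoeth'', 𝔟'', D'', ℬ'', 𝒟'', hseq', S', hsupp', hbd'⟩ :=
        Nr.pieces_loop S hseq hC₀reg hne hP hΓ (B₀ := e.hom ⁻¹' (B' ∪ (C.support : Set Z')))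
          (fun p hp => (hbd p hp).trans (Set.preimage_mono Set.subset_union_left))
          (by rw [hC₀s]; exact Set.preimage_mono Set.subset_union_right) hτ₀
      refine ⟨Z'', hint'', hnoeth'', inferInstance, (τ ≫ e.inv) ≫ ρ, Iso.refl Z'', 𝔟'', D'', ℬ'', 𝒟'', hseq', S', ?_,
        fun p hp => ?_⟩
      · rw [hsupp', hsupp, hC₀s, ← Set.preimage_sdiff, preimage_comp', preimage_inv_preimage_hom, hclX, closure_closure,
          Iso.refl_hom, preimage_id']
      · rw [Iso.refl_hom, preimage_id']
        refine (hbd' p hp).trans ?_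
        rw [preimage_comp', preimage_inv_preimage_hom]


end CJS

end Nr

end WeightTwoB

end Summit.ResolutionOfSingularities.ResolutionOfSingularities.Theorems

end
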